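import Summits.QuantumFields.YangMills.Theorems.AllWindowsColdBoxBulkMidFluxExtensionMismatch

/-!
# LINE-18 (crux `AllWindowsColdBox.BulkMidWindowSU2`, ⟨stmt-QuantumFields-24006⟩), toward the gauge-invariant flux maximum
# principle K3″: the boundary gauge with LINEAR loss — the bound

With the vertex potential `gaugePot H ϑ` of `…BulkMidFluxExtensionMismatch` (cap combs on the two `x₀`-caps of the enlarged
box `Λ⁺ = {−1,…,2H+1}⁴`; on the side the bottom comb plus the vertical line integral minus `(y₀+1)/(2H+2)` times the top-rim
mismatch `h`, `|h| ≤ 15(2H+2)²ε`), this file proves `abs_sub_gaugePot_le`: if every shell plaquette of `Λ⁺` has circulation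
`≤ ε` in absolute value then `|ϑ(e) − (Φ(e⁺) − Φ(e⁻))| ≤ 15(2H+2)·ε` on EVERY tangential shell edge `e` of `Λ⁺` — the four
edge classes: bottom cap / top cap (comb defects), vertical side (`h/(2H+2)`), horizontal side (bottom defect + side strip +
rim variation of `h`).

Finite sums only.  HONEST LABEL: helper toward an UNREGISTERED internal obligation (K3″) of a critic-passed DRAFT line on the
R2ξ″ RECORD-rung crux 24006; no stub, crux, rung or summit is proved here; the Yang–Mills mass gap is NOT proved by this file.
-/

set_option autoImplicit false

noncomputable section

open Classical Finset Function
open Literature.Probability.LatticeModels (Site)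
open Literature.MathematicalPhysics.QuantumFieldTheory
open Literature.MathematicalPhysics.QuantumFieldTheory.LatticeMaxwell

namespace Summit.QuantumFields.YangMills.Theorems.AllWindowsColdBoxBulkMidLine.FluxExt

variable {H : ℕ} {ϑ : Literature.MathematicalPhysics.QuantumLattice.ZdEdge 4 → ℝ} {ε : ℝ} (hε : 0 ≤ ε)
  (hflux : ∀ (z : Site 4) (a b c : Fin 4), a ≠ b → c ≠ a → c ≠ b → (∀ m, -1 ≤ z m ∧ z m ≤ 2 * (H : ℤ) + 1) →
    z a ≤ 2 * (H : ℤ) → z b ≤ 2 * (H : ℤ) → (z c = -1 ∨ z c = 2 * (H : ℤ) + 1) → |sCirc ϑ (z, a, b)| ≤ ε)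

/-! ## Values of the potential -/

/-- On the bottom cap the potential is the bottom comb. -/
theorem gaugePot_of_bot {y : Site 4} (hy0 : y 0 = -1) : gaugePot H ϑ y = potB ϑ y := by
  have hne : ¬ (y 0 = 2 * (H : ℤ) + 1 ∧ ¬ bdY H y) := by rintro ⟨h, -⟩; omega
  have hl : lineInt ϑ 0 y = 0 := by simp [lineInt, hy0]
  have hc : (((y 0 : ℤ) : ℝ) + 1) = 0 := by rw [hy0]; push_cast; ring
  simp only [gaugePot, if_neg hne, hl, hc, zero_div, zero_mul, sub_zero]
  split_ifs <;> simp

/-- On the top cap the potential is the (normalised) top comb. -/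
theorem gaugePot_of_top {y : Site 4} (hy0 : y 0 = 2 * (H : ℤ) + 1) : gaugePot H ϑ y = potT H ϑ y := by
  by_cases hb : bdY H y
  · have hne : ¬ (y 0 = 2 * (H : ℤ) + 1 ∧ ¬ bdY H y) := fun h => h.2 hb
    have hc : (((y 0 : ℤ) : ℝ) + 1) / (2 * H + 2) = 1 := by
      rw [hy0]; push_cast; field_simp; ring
    have hu : update y 0 (2 * (H : ℤ) + 1) = y := by rw [← hy0, update_eq_self]
    simp only [gaugePot, if_neg hne, if_pos hb, hc, one_mul, mis, hu]
    ring
  · simp only [gaugePot, if_pos (And.intro hy0 hb), if_neg hb, add_zero]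

/-- On the side the potential is bottom comb + vertical line integral − `(y₀+1)/(2H+2)·h`. -/
theorem gaugePot_of_side {y : Site 4} (hb : bdY H y) :
    gaugePot H ϑ y = potB ϑ y + lineInt ϑ 0 y - (((y 0 : ℤ) : ℝ) + 1) / (2 * H + 2) * mis H ϑ y := by
  have hne : ¬ (y 0 = 2 * (H : ℤ) + 1 ∧ ¬ bdY H y) := fun h => h.2 hb
  simp only [gaugePot, if_neg hne, if_pos hb]
  ring

/-- A step in direction `i` keeps an extremal coordinate `k ∉ {0,i}` extremal. -/
theorem bdY_add_single {y : Site 4} {i k : Fin 4} (hk0 : k ≠ 0) (hki : k ≠ i)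
    (hyk : y k = -1 ∨ y k = 2 * (H : ℤ) + 1) : bdY H (y + Pi.single i 1) :=
  ⟨k, hk0, by simpa [hki] using hyk⟩

/-! ## The gauge bound -/

include hε hflux in
/-- **The boundary gauge with linear loss.**  If every shell plaquette of the enlarged box has circulation `≤ ε` in absolute
value, then `|ϑ (y, i) − (Φ(y + e_i) − Φ(y))| ≤ 15(2H+2)·ε` for every tangential shell edge `(y, i)` of the enlarged box
(`y ∈ {−1,…,2H+1}⁴`, `y_i ≤ 2H`, some coordinate `k ≠ i` extremal), `Φ = gaugePot H ϑ`. -/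
theorem abs_sub_gaugePot_le {y : Site 4} (hy : ∀ m, -1 ≤ y m ∧ y m ≤ 2 * (H : ℤ) + 1) {i : Fin 4}
    (hyi : y i ≤ 2 * (H : ℤ)) (hk : ∃ k : Fin 4, k ≠ i ∧ (y k = -1 ∨ y k = 2 * (H : ℤ) + 1)) :
    |ϑ (y, i) - (gaugePot H ϑ (y + Pi.single i 1) - gaugePot H ϑ y)| ≤ 15 * (2 * H + 2) * ε := by
  obtain ⟨k, hki, hyk⟩ := hk
  have hM0 : (0 : ℝ) < 2 * H + 2 := by positivity
  have h2M : (4 * (H : ℝ) + 4) * ε ≤ 15 * (2 * H + 2) * ε := by nlinarith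
  by_cases hi : i = 0
  · -- (iii) vertical side edge
    subst hi
    have hk0 : k ≠ 0 := hki
    have hb : bdY H y := ⟨k, hk0, hyk⟩
    have hb' : bdY H (y + Pi.single 0 1) := bdY_add_single hk0 hk0 hyk
    have hpB : potB ϑ (y + Pi.single 0 1) = potB ϑ y := by simp only [potB, update_add_single_self]
    have hmis : mis H ϑ (y + Pi.single 0 1) = mis H ϑ y := by
      simp only [mis, potB, potT, update_add_single_self]
    have hl := lineInt_add_single_self ϑ 0 (hy 0).1
    have hc : ((((y + Pi.single (0 : Fin 4) (1 : ℤ) : Site 4) 0 : ℤ) : ℝ) + 1) = (((y 0 : ℤ) : ℝ) + 1) + 1 := by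
      simp
    rw [gaugePot_of_side hb', gaugePot_of_side hb, hpB, hmis, hl, hc]
    have key : ϑ (y, 0) - (potB ϑ y + (lineInt ϑ 0 y + ϑ (y, 0)) - ((((y 0 : ℤ) : ℝ) + 1 + 1) / (2 * H + 2)) * mis H ϑ y -
        (potB ϑ y + lineInt ϑ 0 y - ((((y 0 : ℤ) : ℝ) + 1) / (2 * H + 2)) * mis H ϑ y)) =
        (1 / (2 * H + 2)) * mis H ϑ y := by
      field_simp; ring
    rw [key, abs_mul, abs_of_pos (by positivity : (0 : ℝ) < 1 / (2 * H + 2))]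
    have := abs_mis_le hε hflux hy hb
    calc 1 / (2 * (H : ℝ) + 2) * |mis H ϑ y| ≤ 1 / (2 * (H : ℝ) + 2) * (15 * (2 * H + 2) ^ 2 * ε) := by gcongr
      _ = 15 * (2 * H + 2) * ε := by field_simp
  · by_cases hy0 : y 0 = -1
    · -- (i) bottom cap edge
      have hy0' : (y + Pi.single i (1 : ℤ) : Site 4) 0 = -1 := by simpa [Ne.symm hi] using hy0
      have hu : update y 0 (-1 : ℤ) = y := by rw [← hy0, update_eq_self]
      rw [gaugePot_of_bot hy0', gaugePot_of_bot hy0]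
      simp only [potB, update_add_single_of_ne hi, hu]
      exact (abs_comb_defect_le' hε hflux hy (Or.inl hy0) hi hyi).trans h2M
    · by_cases hyT : y 0 = 2 * (H : ℤ) + 1
      · -- (ii) top cap edge
        have hyT' : (y + Pi.single i (1 : ℤ) : Site 4) 0 = 2 * (H : ℤ) + 1 := by simpa [Ne.symm hi] using hyT
        have hu : update y 0 (2 * (H : ℤ) + 1) = y := by rw [← hyT, update_eq_self]
        rw [gaugePot_of_top hyT', gaugePot_of_top hyT]
        simp only [potT, update_add_single_of_ne hi, hu, add_sub_add_right_eq_sub]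
        exact (abs_comb_defect_le' hε hflux hy (Or.inr hyT) hi hyi).trans h2M
      · -- (iv) horizontal side edge
        have hk0 : k ≠ 0 := by rintro rfl; rcases hyk with h | h <;> omega
        have hb : bdY H y := ⟨k, hk0, hyk⟩
        have hb' : bdY H (y + Pi.single i 1) := bdY_add_single hk0 hki hyk
        have hc : ((((y + Pi.single i (1 : ℤ) : Site 4) 0 : ℤ) : ℝ) + 1) = (((y 0 : ℤ) : ℝ) + 1) := by
          simp [Ne.symm hi]
        have hli := lineInt_add_single_of_ne ϑ hi (hy 0).1
        have hpB : potB ϑ (y + Pi.single i 1) - potB ϑ y =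
            comb ϑ (update y 0 (-1) + Pi.single i 1) - comb ϑ (update y 0 (-1)) := by
          simp [potB, update_add_single_of_ne hi]
        rw [gaugePot_of_side hb', gaugePot_of_side hb, hc]
        have key : ϑ (y, i) - (potB ϑ (y + Pi.single i 1) + lineInt ϑ 0 (y + Pi.single i 1) -
            (((y 0 : ℤ) : ℝ) + 1) / (2 * H + 2) * mis H ϑ (y + Pi.single i 1) -
            (potB ϑ y + lineInt ϑ 0 y - (((y 0 : ℤ) : ℝ) + 1) / (2 * H + 2) * mis H ϑ y)) =
            (ϑ (update y 0 (-1), i) - (comb ϑ (update y 0 (-1) + Pi.single i 1) - comb ϑ (update y 0 (-1)))) -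
            (∑ m ∈ range (y 0 + 1).toNat, sCirc ϑ (update y 0 (-1 + (m : ℤ)), i, 0)) +
            (((y 0 : ℤ) : ℝ) + 1) / (2 * H + 2) * (mis H ϑ (y + Pi.single i 1) - mis H ϑ y) := by
          linarith [hli, hpB]
        rw [key]
        have d1 := abs_comb_defect_le' hε hflux (range_update_zero hy (Or.inl rfl)) (Or.inl (by simp)) hi
          (by simpa [update_of_ne hi] using hyi)
        have hn : ((y 0 + 1).toNat : ℝ) ≤ 2 * H + 2 := by
          have : (y 0 + 1).toNat ≤ 2 * H + 2 := by have := hy 0; omega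
          exact_mod_cast this
        have d2 : |∑ m ∈ range (y 0 + 1).toNat, sCirc ϑ (update y 0 (-1 + (m : ℤ)), i, 0)| ≤ (2 * H + 2) * ε := by
          refine (abs_sum_range_le fun m hm => ?_).trans (mul_le_mul_of_nonneg_right hn hε)
          refine hflux _ i 0 k hi hki hk0 ?_ ?_ ?_ ?_
          · intro m'; by_cases hm' : m' = 0
            · subst hm'; simp; have := hy 0; omega
            · simp [hm']; exact hy m'
          · simpa [update_of_ne hi] using hyi
          · simp; have := hy 0; omega
          · simpa [update_of_ne hk0] using hyk
        have d3 : |(((y 0 : ℤ) : ℝ) + 1) / (2 * H + 2) * (mis H ϑ (y + Pi.single i 1) - mis H ϑ y)| ≤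
            5 * (2 * H + 2) * ε := by
          rw [abs_mul]
          have hw : |(((y 0 : ℤ) : ℝ) + 1) / (2 * H + 2)| ≤ 1 := by
            rw [abs_of_nonneg (div_nonneg (by have := (hy 0).1; exact_mod_cast (by omega : (0:ℤ) ≤ y 0 + 1)) hM0.le),
              div_le_one hM0]
            have := (hy 0).2
            have : ((y 0 : ℤ) : ℝ) ≤ 2 * H + 1 := by exact_mod_cast this
            linarith
          calc _ ≤ 1 * (5 * (2 * H + 2) * ε) :=
              mul_le_mul hw (abs_mis_step_le hε hflux hy hi hk0 hki hyk hyi) (abs_nonneg _) zero_le_one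
            _ = _ := one_mul _
        calc _ ≤ |ϑ (update y 0 (-1), i) - (comb ϑ (update y 0 (-1) + Pi.single i 1) - comb ϑ (update y 0 (-1)))| +
              |∑ m ∈ range (y 0 + 1).toNat, sCirc ϑ (update y 0 (-1 + (m : ℤ)), i, 0)| +
              |(((y 0 : ℤ) : ℝ) + 1) / (2 * H + 2) * (mis H ϑ (y + Pi.single i 1) - mis H ϑ y)| :=
            (abs_add_le _ _).trans (add_le_add (abs_sub _ _) le_rfl)
          _ ≤ (4 * H + 4) * ε + (2 * H + 2) * ε + 5 * (2 * H + 2) * ε := add_le_add (add_le_add d1 d2) d3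
          _ = 8 * (2 * H + 2) * ε := by ring
          _ ≤ 15 * (2 * H + 2) * ε := by nlinarith

end Summit.QuantumFields.YangMills.Theorems.AllWindowsColdBoxBulkMidLine.FluxExt

end
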